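import Mathlib.LinearAlgebra.Matrix.Determinant.Basic
import Summits.Ventures.Crystal3D.StickySpheres.FccChartLines
import Summits.Ventures.Crystal3D.StickySpheres.FccCubeFacetNoGain
import Literature.MathematicalPhysics.StatisticalMechanics.BarlowCoordination
import HarnessLib

/-!
# The fcc bond frame in coordinates, and the crux's inlined surface tension `φ`

HONEST FRAMING. Part of the venture `Summits/Ventures/Crystal3D` (cell `crystal3d-full`), helper
for the crux `NoReconstructionGain` (stmt-Ventures-19144) of `route-Ventures-StickyWulffConstant`,
line `adhesion`, registered stub `stub_sampleDeficit`.  Coordinate identities for the model fcc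
lattice `Λ₀ = fccStacking 1 √(2/3) = {barlowPos 1 √(2/3) constHagg k i j}`; nothing about
packings.

* `barlowPos_fcc_injective`, `barlowPos_fcc_sub` — `Λ₀` is a lattice with injective integer
  coordinates `(k, i, j)`;
* `norm_barlowPos_fcc_eq_one` — the sites with `i² + j² + k² + ij + ik + jk = 1` are the unit
  (bond) vectors; `det_barlowPos_fcc` — `det` of three sites `= D · √2/2`, `D` the integer
  determinant of the coordinate rows (covolume `√2/2`);
* `inner_barlowPos_fcc` — `⟪(k,i,j), ν⟫ = i⟪u,ν⟫ + j⟪v,ν⟫ + k⟪t,ν⟫`;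
* `finsum_fccShell_abs_inner` — **the crux's inlined `φ` evaluated**: the unit vectors of `Λ₀`
  are the twelve bond vectors `±u, ±v, ±t, ±(u−v), ±(u−t), ±(v−t)` (`touching_eq_union` of
  `BarlowCoordination`), so `∑ᶠ_{w ∈ Λ₀, ‖w‖ = 1} |⟪w, ν⟫| = 2 (|⟪u,ν⟫| + |⟪v,ν⟫| + |⟪t,ν⟫| +
  |⟪u−v,ν⟫| + |⟪u−t,ν⟫| + |⟪v−t,ν⟫|)` for EVERY `ν` — the six `⟨110⟩` line classes, each counted
  with both orientations.

WHAT THIS IS NOT: no counting of lines or deficiencies (see `…NoReconstructionGainLineCount`,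
`…NoReconstructionGainSampleDeficit`); rung F-C1 not moved.
-/

noncomputable section

namespace Summit.Ventures.Crystal3D.Theorems

open Summit.Ventures.Crystal3D Matrix Finset
open Literature.MathematicalPhysics.StatisticalMechanics (barlowPos barlowStacking fccStacking
  constHagg haggLabel_const isHaggSeq_const barlowPos_mem barlowPos_apply_zero barlowPos_apply_one
  barlowPos_apply_two le_dist_barlowPos_of_ideal offsetPos offsetPos_injective offsetPos_layer_eq
  sixOffsets threeOffsets touching_eq_union)
open scoped InnerProductSpace

/-- `h² = ⅔ a²` for the model fcc stacking `a = 1`, `h = √(2/3)`. -/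
theorem fcc_height_sq : Real.sqrt (2 / 3) ^ 2 = 2 / 3 * (1 : ℝ) ^ 2 := by
  rw [Real.sq_sqrt (by norm_num)]; ring

/-- Injectivity of the integer coordinates of the model fcc stacking. -/
theorem barlowPos_fcc_injective {k₁ i₁ j₁ k₂ i₂ j₂ : ℤ}
    (h : barlowPos 1 (Real.sqrt (2 / 3)) constHagg k₁ i₁ j₁ =
      barlowPos 1 (Real.sqrt (2 / 3)) constHagg k₂ i₂ j₂) : (k₁, i₁, j₁) = (k₂, i₂, j₂) := by
  by_contra hne
  have h1 := le_dist_barlowPos_of_ideal isHaggSeq_const one_pos fcc_height_sq hne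
  rw [h, dist_self] at h1
  exact absurd h1 (by norm_num)

/-- Differences of fcc sites are fcc sites (the stacking with constant Hägg sequence is a lattice). -/
theorem barlowPos_fcc_sub (k₁ i₁ j₁ k₂ i₂ j₂ : ℤ) :
    barlowPos 1 (Real.sqrt (2 / 3)) constHagg k₁ i₁ j₁ - barlowPos 1 (Real.sqrt (2 / 3)) constHagg k₂ i₂ j₂ =
      barlowPos 1 (Real.sqrt (2 / 3)) constHagg (k₁ - k₂) (i₁ - i₂) (j₁ - j₂) := by
  rw [barlowPos_fcc_linear 1 _ k₁, barlowPos_fcc_linear 1 _ k₂, barlowPos_fcc_linear 1 _ (k₁ - k₂)]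
  push_cast
  module

/-- The nearest-neighbour sites of the model fcc stacking have norm one:
`‖(k,i,j)‖ = 1` when `i² + j² + k² + ij + ik + jk = 1`. -/
theorem norm_barlowPos_fcc_eq_one {k i j : ℤ} (h : i ^ 2 + j ^ 2 + k ^ 2 + i * j + i * k + j * k = 1) :
    ‖barlowPos 1 (Real.sqrt (2 / 3)) constHagg k i j‖ = 1 := by
  have h2 := norm_sq_barlowPos_fcc k i j
  rw [h] at h2; push_cast at h2
  have h0 : 0 ≤ ‖barlowPos 1 (Real.sqrt (2 / 3)) constHagg k i j‖ := norm_nonneg _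
  nlinarith

/-- Determinant of three fcc sites in coordinates: `det = D · √2/2` with `D` the integer
determinant of the coefficient rows `(i, j, k)`. -/
theorem det_barlowPos_fcc (k₁ i₁ j₁ k₂ i₂ j₂ k₃ i₃ j₃ : ℤ) :
    Matrix.det ![WithLp.ofLp (barlowPos 1 (Real.sqrt (2 / 3)) constHagg k₁ i₁ j₁),
        WithLp.ofLp (barlowPos 1 (Real.sqrt (2 / 3)) constHagg k₂ i₂ j₂),
        WithLp.ofLp (barlowPos 1 (Real.sqrt (2 / 3)) constHagg k₃ i₃ j₃)] =
      ((i₁ * (j₂ * k₃ - k₂ * j₃) - j₁ * (i₂ * k₃ - k₂ * i₃) + k₁ * (i₂ * j₃ - j₂ * i₃) : ℤ) : ℝ) *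
        (Real.sqrt 2 / 2) := by
  have h : Real.sqrt 3 * Real.sqrt (2 / 3) = Real.sqrt 2 := by
    rw [← Real.sqrt_mul (by norm_num)]; norm_num
  rw [Matrix.det_fin_three]
  simp only [Matrix.cons_val_zero, Matrix.cons_val_one, Matrix.cons_val]
  simp only [barlowPos_apply_zero, barlowPos_apply_one, barlowPos_apply_two, haggLabel_const, one_mul]
  push_cast
  linear_combination ((i₁ * (j₂ * k₃ - k₂ * j₃) - j₁ * (i₂ * k₃ - k₂ * i₃) + k₁ * (i₂ * j₃ - j₂ * i₃) : ℝ) / 2) * h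

/-- Inner products of fcc sites with a fixed vector are ℤ-linear in the coordinates:
`⟪(k,i,j), ν⟫ = i⟪u,ν⟫ + j⟪v,ν⟫ + k⟪t,ν⟫`. -/
theorem inner_barlowPos_fcc (k i j : ℤ) (ν : EuclideanSpace ℝ (Fin 3)) :
    ⟪barlowPos 1 (Real.sqrt (2 / 3)) constHagg k i j, ν⟫_ℝ =
      (i : ℝ) * ⟪barlowPos 1 (Real.sqrt (2 / 3)) constHagg 0 1 0, ν⟫_ℝ +
        (j : ℝ) * ⟪barlowPos 1 (Real.sqrt (2 / 3)) constHagg 0 0 1, ν⟫_ℝ +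
        (k : ℝ) * ⟪barlowPos 1 (Real.sqrt (2 / 3)) constHagg 1 0 0, ν⟫_ℝ := by
  rw [barlowPos_fcc_linear 1 _ k i j, inner_add_left, inner_add_left, inner_smul_left,
    inner_smul_left, inner_smul_left]
  simp

/-- **The crux's inlined `φ`, evaluated.**  The unit vectors of the model fcc lattice
`Λ₀ = fccStacking 1 √(2/3)` are the twelve bond vectors `±u, ±v, ±t, ±(u−v), ±(u−t), ±(v−t)`
(`u, v, t` the images of `(0,1,0), (0,0,1), (1,0,0)`), so for every `ν`
`∑ᶠ_{w ∈ Λ₀, ‖w‖ = 1} |⟪w, ν⟫| = 2 (|⟪u,ν⟫| + |⟪v,ν⟫| + |⟪t,ν⟫| + |⟪u−v,ν⟫| + |⟪u−t,ν⟫| + |⟪v−t,ν⟫|)`. -/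
theorem finsum_fccShell_abs_inner (ν : EuclideanSpace ℝ (Fin 3)) :
    ∑ᶠ w ∈ {w ∈ fccStacking 1 (Real.sqrt (2 / 3)) | ‖w‖ = 1}, |⟪w, ν⟫_ℝ| =
      2 * (|⟪barlowPos 1 (Real.sqrt (2 / 3)) constHagg 0 1 0, ν⟫_ℝ| +
        |⟪barlowPos 1 (Real.sqrt (2 / 3)) constHagg 0 0 1, ν⟫_ℝ| +
        |⟪barlowPos 1 (Real.sqrt (2 / 3)) constHagg 1 0 0, ν⟫_ℝ| +
        |⟪barlowPos 1 (Real.sqrt (2 / 3)) constHagg 0 1 0 -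
            barlowPos 1 (Real.sqrt (2 / 3)) constHagg 0 0 1, ν⟫_ℝ| +
        |⟪barlowPos 1 (Real.sqrt (2 / 3)) constHagg 0 1 0 -
            barlowPos 1 (Real.sqrt (2 / 3)) constHagg 1 0 0, ν⟫_ℝ| +
        |⟪barlowPos 1 (Real.sqrt (2 / 3)) constHagg 0 0 1 -
            barlowPos 1 (Real.sqrt (2 / 3)) constHagg 1 0 0, ν⟫_ℝ|) := by
  classical
  -- the shell about the origin
  have hset : {w ∈ fccStacking 1 (Real.sqrt (2 / 3)) | ‖w‖ = 1} =
      {w | w ∈ barlowStacking 1 (Real.sqrt (2 / 3)) constHagg ∧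
        dist (barlowPos 1 (Real.sqrt (2 / 3)) constHagg 0 0 0) w = 1} := by
    ext w
    simp only [Set.mem_setOf_eq, fccStacking, barlowPos_zero_zero_zero, dist_eq_norm, zero_sub,
      norm_neg]
  rw [hset, touching_eq_union isHaggSeq_const one_pos fcc_height_sq 0 0 0]
  -- the three layers are pairwise disjoint finite sets
  have hh0 : Real.sqrt (2 / 3) ≠ 0 := by positivity
  have hinj := fun k' => offsetPos_injective (h := Real.sqrt (2 / 3)) (s := constHagg) one_pos 0 0 k'
  have hlay : ∀ {k₁ k₂ : ℤ} (A B : Finset (ℤ × ℤ)), k₁ ≠ k₂ →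
      Disjoint (offsetPos 1 (Real.sqrt (2 / 3)) constHagg 0 0 k₁ '' ↑A)
        (offsetPos 1 (Real.sqrt (2 / 3)) constHagg 0 0 k₂ '' ↑B) := by
    intro k₁ k₂ A B hk
    refine Set.disjoint_left.2 ?_
    rintro _ ⟨PQ, _, rfl⟩ ⟨PQ', _, heq⟩
    exact hk (offsetPos_layer_eq hh0 heq.symm)
  have hfin : ∀ (k' : ℤ) (A : Finset (ℤ × ℤ)),
      (offsetPos 1 (Real.sqrt (2 / 3)) constHagg 0 0 k' '' ↑A).Finite :=
    fun k' A => A.finite_toSet.image _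
  rw [finsum_mem_union ((hlay _ _ (by omega)).union_right (hlay _ _ (by omega))) (hfin _ _)
      ((hfin _ _).union (hfin _ _)),
    finsum_mem_union (hlay _ _ (by omega)) (hfin _ _) (hfin _ _),
    finsum_mem_image (hinj _).injOn, finsum_mem_image (hinj _).injOn,
    finsum_mem_image (hinj _).injOn,
    finsum_mem_coe_finset, finsum_mem_coe_finset, finsum_mem_coe_finset]
  -- evaluate the three finite sums
  simp only [constHagg, sixOffsets, threeOffsets, if_true, show (-1 : ℤ) ≠ 1 by decide, if_false]
  rw [Finset.sum_insert (by decide), Finset.sum_insert (by decide), Finset.sum_insert (by decide),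
    Finset.sum_insert (by decide), Finset.sum_insert (by decide), Finset.sum_singleton,
    Finset.sum_insert (by decide), Finset.sum_insert (by decide), Finset.sum_singleton,
    Finset.sum_insert (by decide), Finset.sum_insert (by decide), Finset.sum_singleton]
  simp only [offsetPos, inner_sub_left]
  set A := ⟪barlowPos 1 (Real.sqrt (2 / 3)) constHagg 0 1 0, ν⟫_ℝ with hA
  set B := ⟪barlowPos 1 (Real.sqrt (2 / 3)) constHagg 0 0 1, ν⟫_ℝ with hB
  set T := ⟪barlowPos 1 (Real.sqrt (2 / 3)) constHagg 1 0 0, ν⟫_ℝ with hT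
  have key : ∀ k i j : ℤ, ⟪barlowPos 1 (Real.sqrt (2 / 3)) constHagg k i j, ν⟫_ℝ =
      (i : ℝ) * A + (j : ℝ) * B + (k : ℝ) * T := fun k i j => by
    rw [hA, hB, hT]; exact inner_barlowPos_fcc k i j ν
  simp only [key]
  push_cast
  ring_nf
  rw [abs_neg, abs_neg, abs_neg, neg_add_eq_sub, neg_add_eq_sub, neg_add_eq_sub, abs_sub_comm B A,
    abs_sub_comm T A, abs_sub_comm T B]
  ring

end Summit.Ventures.Crystal3D.Theorems

end
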